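import Literature.AlgebraicGeometry.GroupSchemes.HopfIdealOfFiniteSubgroupOfPoints
import Literature.AlgebraicGeometry.GroupSchemes.UnitComponentReductionKernel
import Literature.RingTheory.Ideal.ComaximalKernelsOfLocalSections
import HarnessLib

/-!
# A finite subgroup of sections of a finite group scheme over a henselian local ring meeting the unit component trivially reduces
# injectively and has a FINITE ÉTALE closed subgroup scheme as closure ([Tate1997FiniteFlatGroupSchemes] (3.7); [StacksProject] 04GG)

Topic `Literature/AlgebraicGeometry/GroupSchemes`, namespace `Literature.AlgebraicGeometry.GroupSchemes.FiniteSubgroupOfSections`.  THEOREMS ONLY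
(no definition, no instance, no notation, no named fact, no `sorry`).  Generic form (any universe, `IsUnitComponent` UNBUNDLED into its four
clauses as in ★ `UnitComponentReductionKernel` p844805, so that no `Cruxes/…/Lines` module is imported) of
`stub_b4g_etaleClosureOfGenericSubgroup_henselian` of the organ sub-line `Cruxes/HLiu418/Lines/F0_P6b_ConnectedEtale.lean` ED. 2 (cell
`pub/hodgecm-mathlib`, D-0151, programme P6 «MOD», HEART input (b4); desk F0P6b-plan (g0) 13:42:14Z ∕ 13:52:10Z, strategy σ2 «SECTIONS FIRST»,
hand B-p12 (g30); twin σ1 F0P6-p10 (g0) yielded 13:52:09Z).  Generic capital `--supports stmt-HodgeConjecture-24832`.  HONEST LABEL: HC_CM is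
proved only modulo the cell's 2 remaining named inputs (hLiu418 24832, h413 24833) until rung 0 closes; this file pays no letter.

THE MATHEMATICS.  `R` henselian local, `G → Spec R` a FINITE group scheme, `j : G₀ ↪ G` an open-and-closed homomorphic immersion with `G₀`
connected (the unit component), `C ≤ G(R)` a FINITE subgroup of SECTIONS with `C ∩ G₀(R) = 1`.
* §1 INJECTIVE REDUCTION (`eq_of_reduction_eq`): sections are a group (Mathlib `Hom.group`) and reduction `G(R) → G(κ)` (precomposition
  with `Spec κ → Spec R`, i.e. with `toUnit` of the test object `Spec κ` over `R`) is a homomorphism (`MonObj.comp_mul`, `GrpObj.comp_inv`);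
  if `s₁, s₂ ∈ C` have the same reduction then `s₁s₂⁻¹ ∈ C` reduces to the unit, hence factors through `G₀` by ★
  `UnitComponent.exists_factor_iff_reduction_eq_unit` (at `R′ = R`, `f = id`) [Tate1997FiniteFlatGroupSchemes (3.7)], hence is `1`.
* §2 THE ÉTALE CLOSURE (`exists_etale_closedSubgroup`): read the sections through the test object `specOver R R ≅ 𝟙_` (★ `unitIsoSpecOver`)
  as the finite family `u : C → G(Spec R)`, closed under the group law; by §1 and ★ `Ideal.comap_maximalIdeal_eq_iff_residue_eq` +
  ★ `ptEquiv_comap` their algebra maps `φ_s : Γ(G) → R` have pairwise DISTINCT closed points, so the evaluation map `Γ(G) → R^C` is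
  SURJECTIVE (CRT, ★ `Ideal.surjective_pi_of_pairwise_comap_maximalIdeal_ne`); ★ `AffineGroupScheme.exists_etale_closedSubgroup_of_points`
  then yields the closed subgroup scheme `c : C̄ = Spec (Γ(G) ⧸ ⋂ ker φ_s) ↪ G`, finite étale over `R`, whose sections are exactly `C`.
* §3 HEAD `injective_reduction_and_exists_etale_closedSubgroup` = §1 ∧ §2 in the letter of the stub (conjunction, `Over (Spec (.of R))`).

## References
* [Tate1997FiniteFlatGroupSchemes] J. Tate, *Finite flat group schemes*, in: Modular Forms and Fermat's Last Theorem (1997), (3.7).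
* [SerreTate1968] J.-P. Serre, J. Tate, *Good reduction of abelian varieties*, Ann. of Math. 88 (1968), §1 Lemma 1.
* [StacksProject] The Stacks Project, Tag 04GG (finite algebras over henselian local rings; sections ↔ factors `≅ R`).
* [GortzWedhorn2023] U. Görtz, T. Wedhorn, *Algebraic Geometry II* (2023), §(27.2) p. 607 (closed subgroup schemes ↔ Hopf ideals).
-/

set_option autoImplicit false

-- Mathlib's `Over`/`Scheme` APIs are stated across semireducible wrappers (as in the ★ `GroupSchemes/*` files).
set_option backward.isDefEq.respectTransparency false

universe u

open CategoryTheory CategoryTheory.Limits AlgebraicGeometry MonoidalCategory CartesianMonoidalCategory IsLocalRing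

namespace Literature.AlgebraicGeometry.GroupSchemes

namespace FiniteSubgroupOfSections

open scoped MonObj

open Literature.AlgebraicGeometry.Motives AffineGroupScheme

variable (R : Type u) [CommRing R]

/-! ## §1 Reduction of sections; injectivity on a subgroup meeting the unit component trivially -/

/-- **The reduction of a section, as a point**: for the test object `T = (Spec κ(R) → Spec R)` and a section `s`, the point `toUnit T ≫ s`
of `G` has underlying morphism `Spec κ(R) → Spec R → G`. [cite: StacksProject, Tag 04GG] -/
theorem toUnit_comp_left [IsLocalRing R] (G : Over (Spec (CommRingCat.of R))) (s : 𝟙_ (Over (Spec (CommRingCat.of R))) ⟶ G) :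
    (toUnit (Over.mk (Spec.map (CommRingCat.ofHom (residue R)))) ≫ s).left = Spec.map (CommRingCat.ofHom (residue R)) ≫ s.left :=
  rfl

/-- **Reduction is a homomorphism on sections**: `s ↦ toUnit T ≫ s` respects `s₁ s₂⁻¹` (Mathlib `MonObj.comp_mul`, `GrpObj.comp_inv`), so two
sections with the same reduction have a quotient reducing to the unit point. [cite: Tate1997FiniteFlatGroupSchemes, (3.7)] -/
theorem reduction_mul_inv_eq_unit [IsLocalRing R] (G : Over (Spec (CommRingCat.of R))) [GrpObj G]
    {s₁ s₂ : 𝟙_ (Over (Spec (CommRingCat.of R))) ⟶ G}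
    (h : Spec.map (CommRingCat.ofHom (residue R)) ≫ s₁.left = Spec.map (CommRingCat.ofHom (residue R)) ≫ s₂.left) :
    Spec.map (CommRingCat.ofHom (residue R)) ≫ (s₁ * s₂⁻¹).left =
      Spec.map (CommRingCat.ofHom ((residue R).comp (RingHom.id R))) ≫ (η[G] : 𝟙_ _ ⟶ G).left := by
  let T : Over (Spec (CommRingCat.of R)) := Over.mk (Spec.map (CommRingCat.ofHom (residue R)))
  -- the two reductions are the same `κ(R)`-point
  have h12 : toUnit T ≫ s₁ = toUnit T ≫ s₂ := Over.OverMorphism.ext h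
  have hmul : toUnit T ≫ (s₁ * s₂⁻¹) = 1 := by
    rw [MonObj.comp_mul, GrpObj.comp_inv, h12, mul_inv_cancel]
  have hl : (toUnit T ≫ (s₁ * s₂⁻¹)).left = (1 : T ⟶ G).left := by rw [hmul]
  rw [RingHom.comp_id]
  exact hl

variable [HenselianLocalRing R] (G G₀ : Over (Spec (CommRingCat.of R))) [GrpObj G] [GrpObj G₀] (j : G₀ ⟶ G) [IsMonHom j]
  [IsOpenImmersion j.left] [IsClosedImmersion j.left] [ConnectedSpace G₀.left] [IsFinite G.hom]

/-- **A section reducing to the unit factors through the unit component** (★ `UnitComponent.exists_factor_iff_reduction_eq_unit` at `R′ = R`,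
`f = id`, repackaged over `Spec R`: the factorisation `Spec R → G₀` is a section of `G₀`). [cite: Tate1997FiniteFlatGroupSchemes, (3.7)] -/
theorem exists_section_comp_eq_of_reduction_eq_unit (s : 𝟙_ (Over (Spec (CommRingCat.of R))) ⟶ G)
    (h : Spec.map (CommRingCat.ofHom (residue R)) ≫ s.left =
      Spec.map (CommRingCat.ofHom ((residue R).comp (RingHom.id R))) ≫ (η[G] : 𝟙_ _ ⟶ G).left) :
    ∃ s₀ : 𝟙_ (Over (Spec (CommRingCat.of R))) ⟶ G₀, s₀ ≫ j = s := by
  have ht : s.left ≫ G.hom = Spec.map (CommRingCat.ofHom (RingHom.id R)) := by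
    rw [Over.w s, Over.tensorUnit_hom, CommRingCat.ofHom_id, Spec.map_id]
  obtain ⟨t₀, ht₀⟩ := (UnitComponent.exists_factor_iff_reduction_eq_unit R G G₀ j R (RingHom.id R) s.left ht).2 h
  exact ⟨Over.homMk t₀ (by rw [← Over.w j, ← Category.assoc, ht₀, Over.w s]), Over.OverMorphism.ext ht₀⟩

/-- **INJECTIVE REDUCTION ON A SUBGROUP OF SECTIONS MEETING `G₀` TRIVIALLY.**  `R` henselian local, `G` finite over `Spec R` with unit
component `j : G₀ ↪ G` (homomorphic open-and-closed immersion, `G₀` connected), `C ≤ G(R)` a subgroup of sections with `C ∩ G₀(R) = 1`: two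
sections in `C` with the same reduction `Spec κ(R) → G` are EQUAL (`s₁s₂⁻¹ ∈ C` reduces to the unit, so lies in `G₀(R)`, so is `1`).
[cite: Tate1997FiniteFlatGroupSchemes, (3.7)] [cite: SerreTate1968, §1 Lemma 1] -/
theorem eq_of_reduction_eq (C : Subgroup (𝟙_ (Over (Spec (CommRingCat.of R))) ⟶ G))
    (hC₀ : ∀ s ∈ C, (∃ s₀ : 𝟙_ (Over (Spec (CommRingCat.of R))) ⟶ G₀, s₀ ≫ j = s) → s = 1)
    {s₁ s₂ : 𝟙_ (Over (Spec (CommRingCat.of R))) ⟶ G} (hs₁ : s₁ ∈ C) (hs₂ : s₂ ∈ C)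
    (h : Spec.map (CommRingCat.ofHom (residue R)) ≫ s₁.left = Spec.map (CommRingCat.ofHom (residue R)) ≫ s₂.left) : s₁ = s₂ :=
  mul_inv_eq_one.1 (hC₀ _ (C.mul_mem hs₁ (C.inv_mem hs₂))
    (exists_section_comp_eq_of_reduction_eq_unit R G G₀ j _ (reduction_mul_inv_eq_unit R G h)))

/-! ## §2 The étale closure of a finite subgroup of sections meeting `G₀` trivially -/

omit [HenselianLocalRing R] [GrpObj G] [IsFinite G.hom] in
/-- The sections read through the test object `specOver R R ≅ 𝟙_` (★ `unitIsoSpecOver`): underlying morphisms are unchanged.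
[cite: GortzWedhorn2023, §(27.2) (p. 606)] -/
theorem unitIsoSpecOver_inv_comp_left (s : 𝟙_ (Over (Spec (CommRingCat.of R))) ⟶ G) :
    ((unitIsoSpecOver (R := R)).inv ≫ s).left = s.left := by
  have hinv : (unitIsoSpecOver (R := R)).inv.left = 𝟙 (Spec (CommRingCat.of R)) := by
    simp [unitIsoSpecOver]
  rw [Over.comp_left, hinv]
  exact Category.id_comp _

/-- **Sections in `C` have pairwise DISTINCT CLOSED POINTS**: if the algebra maps `φ_{s₁}, φ_{s₂} : Γ(G) → R` of two sections in `C` have the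
same closed point `φ⁻¹(𝔪_R)` then their reductions mod `𝔪_R` agree (★ `Ideal.comap_maximalIdeal_eq_iff_residue_eq`), i.e. the points
`Spec κ(R) → G` agree (★ `ptEquiv_comap` naturality), so `s₁ = s₂` by §1. [cite: StacksProject, Tag 04GG] [cite: Tate1997FiniteFlatGroupSchemes, (3.7)] -/
theorem eq_of_comap_maximalIdeal_ptEquiv_eq (C : Subgroup (𝟙_ (Over (Spec (CommRingCat.of R))) ⟶ G))
    (hC₀ : ∀ s ∈ C, (∃ s₀ : 𝟙_ (Over (Spec (CommRingCat.of R))) ⟶ G₀, s₀ ≫ j = s) → s = 1)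
    {s₁ s₂ : 𝟙_ (Over (Spec (CommRingCat.of R))) ⟶ G} (hs₁ : s₁ ∈ C) (hs₂ : s₂ ∈ C)
    (h : letI : IsAffine G.left := isAffine_left_of_isAffineHom G
      (maximalIdeal R).comap (ptEquiv G R ((unitIsoSpecOver (R := R)).inv ≫ s₁)) =
        (maximalIdeal R).comap (ptEquiv G R ((unitIsoSpecOver (R := R)).inv ≫ s₂))) : s₁ = s₂ := by
  letI : IsAffine G.left := isAffine_left_of_isAffineHom G
  refine eq_of_reduction_eq R G G₀ j C hC₀ hs₁ hs₂ ?_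
  -- equal closed points ⇒ equal reductions of the algebra maps
  have hres := (Literature.RingTheory.Ideal.comap_maximalIdeal_eq_iff_residue_eq _ _).1 h
  -- as `κ(R)`-points: `Spec κ → Spec R → G`
  set ψ : R →ₐ[R] ResidueField R := Algebra.ofId R (ResidueField R) with hψ
  have hpt : ψ.comp (ptEquiv G R ((unitIsoSpecOver (R := R)).inv ≫ s₁)) = ψ.comp (ptEquiv G R ((unitIsoSpecOver (R := R)).inv ≫ s₂)) := by
    refine AlgHom.ext fun b => ?_
    rw [AlgHom.comp_apply, AlgHom.comp_apply, Algebra.ofId_apply, Algebra.ofId_apply, ResidueField.algebraMap_eq]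
    exact hres b
  rw [← ptEquiv_comap, ← ptEquiv_comap] at hpt
  have hl := congrArg (fun f => f.left) ((ptEquiv G (ResidueField R)).injective hpt)
  simp only [Over.comp_left, AlgPoints.specOverMapOfAlgHom_left] at hl
  rw [← Over.comp_left, ← Over.comp_left, unitIsoSpecOver_inv_comp_left, unitIsoSpecOver_inv_comp_left] at hl
  have hψr : ψ.toRingHom = residue R := ResidueField.algebraMap_eq R
  rw [hψr] at hl
  exact hl

/-- **THE ÉTALE CLOSURE OF A FINITE SUBGROUP OF SECTIONS MEETING `G₀` TRIVIALLY.**  `R` henselian local, `G` finite over `Spec R` with unit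
component `j : G₀ ↪ G`, `C ≤ G(R)` a FINITE subgroup of sections with `C ∩ G₀(R) = 1`.  THEN there is a closed subgroup scheme `c : C̄ ↪ G`
(homomorphic closed immersion), `C̄ → Spec R` FINITE ÉTALE, whose sections are EXACTLY `C`: `C̄ = Spec (Γ(G) ⧸ ⋂_{s ∈ C} ker φ_s) ≅ ∐_C Spec R`
(§2 distinct closed points ⇒ CRT ★ `Ideal.surjective_pi_of_pairwise_comap_maximalIdeal_ne`; Hopf ideal + points + finite étale ★
`AffineGroupScheme.exists_etale_closedSubgroup_of_points`). [cite: Tate1997FiniteFlatGroupSchemes, (3.7)] [cite: StacksProject, Tag 04GG]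
[cite: GortzWedhorn2023, §(27.2) (p. 607)] -/
theorem exists_etale_closedSubgroup (C : Subgroup (𝟙_ (Over (Spec (CommRingCat.of R))) ⟶ G))
    (hC : (C : Set (𝟙_ (Over (Spec (CommRingCat.of R))) ⟶ G)).Finite)
    (hC₀ : ∀ s ∈ C, (∃ s₀ : 𝟙_ (Over (Spec (CommRingCat.of R))) ⟶ G₀, s₀ ≫ j = s) → s = 1) :
    ∃ (Cbar : Over (Spec (CommRingCat.of R))) (_ : GrpObj Cbar) (c : Cbar ⟶ G),
      IsMonHom c ∧ IsClosedImmersion c.left ∧ IsFinite Cbar.hom ∧ Etale Cbar.hom ∧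
        ∀ s : 𝟙_ (Over (Spec (CommRingCat.of R))) ⟶ G, s ∈ C ↔ ∃ sbar : 𝟙_ (Over (Spec (CommRingCat.of R))) ⟶ Cbar, sbar ≫ c = s := by
  letI : IsAffine G.left := isAffine_left_of_isAffineHom G
  haveI : Finite C := hC.to_subtype
  -- the sections of `C` as points on the test object `specOver R R ≅ 𝟙_`
  let u : C → (specOver R R ⟶ G) := fun s => (unitIsoSpecOver (R := R)).inv ≫ (s : 𝟙_ (Over (Spec (CommRingCat.of R))) ⟶ G)
  have hone : ∃ i, u i = 1 := ⟨⟨1, C.one_mem⟩, MonObj.comp_one _⟩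
  have hmul : ∀ i k, ∃ l, u l = u i * u k := fun i k => ⟨⟨i.1 * k.1, C.mul_mem i.2 k.2⟩, MonObj.comp_mul _ _ _⟩
  have hinv : ∀ i, ∃ l, u l = (u i)⁻¹ := fun i => ⟨⟨i.1⁻¹, C.inv_mem i.2⟩, GrpObj.comp_inv _ _⟩
  -- distinct closed points ⇒ the evaluation map is surjective (CRT)
  have hπ : Function.Surjective (AlgHom.pi fun i => ptEquiv G R (u i) : Alg G →ₐ[R] (C → R)) :=
    Literature.RingTheory.Ideal.surjective_pi_of_pairwise_comap_maximalIdeal_ne _ fun i k hik h =>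
      hik (Subtype.ext (eq_of_comap_maximalIdeal_ptEquiv_eq R G G₀ j C hC₀ i.2 k.2 h))
  obtain ⟨H, GH, c, hhom, hci, hfin, het, hpts⟩ := exists_etale_closedSubgroup_of_points G u hπ hone hmul hinv
  refine ⟨H, GH, c, hhom, hci, hfin, het, fun s => ⟨fun hs => ?_, ?_⟩⟩
  · obtain ⟨x, hx⟩ := (hpts ((unitIsoSpecOver (R := R)).inv ≫ s)).2 ⟨⟨s, hs⟩, rfl⟩
    exact ⟨(unitIsoSpecOver (R := R)).hom ≫ x, by rw [Category.assoc, hx, Iso.hom_inv_id_assoc]⟩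
  · rintro ⟨sbar, hsbar⟩
    obtain ⟨i, hi⟩ := (hpts ((unitIsoSpecOver (R := R)).inv ≫ s)).1 ⟨(unitIsoSpecOver (R := R)).inv ≫ sbar, by rw [Category.assoc, hsbar]⟩
    have hsi : s = i.1 := by
      rw [← cancel_epi (unitIsoSpecOver (R := R)).inv]
      exact hi
    rw [hsi]
    exact i.2

/-! ## §3 HEAD: the letter of `stub_b4g` (conjunction) -/

/-- **HEAD (generic `stub_b4g_etaleClosureOfGenericSubgroup_henselian`, `IsUnitComponent` unbundled).**  Over a henselian local ring `R`,
`G` finite over `Spec R` with unit component `j : G₀ ↪ G` (homomorphic, open and closed immersion, `G₀` connected), `C ≤ G(R)` a finite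
subgroup of sections meeting `G₀(R)` trivially: (i) reduction `Spec κ(R) → G` is injective on `C` (§1) and (ii) there is a closed subgroup
scheme `c : C̄ ↪ G`, finite étale over `Spec R`, whose sections are exactly `C` (§2). [cite: Tate1997FiniteFlatGroupSchemes, (3.7)]
[cite: SerreTate1968, §1 Lemma 1] [cite: StacksProject, Tag 04GG] -/
theorem injective_reduction_and_exists_etale_closedSubgroup (C : Subgroup (𝟙_ (Over (Spec (CommRingCat.of R))) ⟶ G))
    (hC : (C : Set (𝟙_ (Over (Spec (CommRingCat.of R))) ⟶ G)).Finite)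
    (hC₀ : ∀ s ∈ C, (∃ s₀ : 𝟙_ (Over (Spec (CommRingCat.of R))) ⟶ G₀, s₀ ≫ j = s) → s = 1) :
    (∀ s₁ ∈ C, ∀ s₂ ∈ C,
        Spec.map (CommRingCat.ofHom (residue R)) ≫ s₁.left = Spec.map (CommRingCat.ofHom (residue R)) ≫ s₂.left → s₁ = s₂) ∧
    ∃ (Cbar : Over (Spec (CommRingCat.of R))) (_ : GrpObj Cbar) (c : Cbar ⟶ G),
      IsMonHom c ∧ IsClosedImmersion c.left ∧ IsFinite Cbar.hom ∧ Etale Cbar.hom ∧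
        ∀ s : 𝟙_ (Over (Spec (CommRingCat.of R))) ⟶ G, s ∈ C ↔ ∃ sbar : 𝟙_ (Over (Spec (CommRingCat.of R))) ⟶ Cbar, sbar ≫ c = s :=
  ⟨fun _ hs₁ _ hs₂ h => eq_of_reduction_eq R G G₀ j C hC₀ hs₁ hs₂ h, exists_etale_closedSubgroup R G G₀ j C hC hC₀⟩

end FiniteSubgroupOfSections

end Literature.AlgebraicGeometry.GroupSchemes
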